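import Summits.Parity.GeneralizedHardyLittlewood.Theorems.LeeYangFibresRelativeDimOneSplitCosetDegenerate
import Summits.Parity.GeneralizedHardyLittlewood.Theorems.LeeYangFibresRelativeDimOneSplitCosetDiscrepancy
import HarnessLib

/-!
# The coset discrepancy at a fixed scale (crux stmt-Parity-14113 `LeeYangFibres.RelativeDimOne`,
line gallagher-backwards-split, stub `stub_inversion`, PIECE 3e)

We instantiate the abstract discrepancy inequality (`coset_discrepancy_abstract`) with the concrete
objects of the line at a fixed scale `N`: a modulus `q ≥ 1`, a coefficient vector `a` (`a_i ≠ 0`),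
residues `c`, a box of shifts `B = ∏ [u_i, u_i + X_i]` whose moving windows along `n < W` are positive
(`1 ≤ a_i n + u_i`) and of height `≤ M`, two spectra `f, g` of level `⌊N^θ⌋`, and the four inputs in
exactly the shape the neighbouring statements deliver them:
* the core on the window `K_W = [0, W − 1]` for the non-degenerate shifts of the coset (output of
  `IncidenceBandlimitedCore`), converted by `vonMangoldtSum_sys_window` / `archFactor_sys_window`;
* `|𝔖 − bandSum g| ≤ ε₂` (output of `SingularSeriesBandlimited`);
* the moving class moment (output of `MovingClassMoments`), converted by the DICTIONARY
  `dictionary_identity`, the window count `abs_card_window_coprime_sub_le` and the LOCAL IDENTITY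
  `card_coprime_classes_eq` into `|Σ_{b ∈ C} S_b − W · LTF · P| ≤ (q/φ(q))^t P (q + ε₃ W)`;
* the coset singular mean (output of `CosetSingularMean`).
The counts `|#C − P| ≤ ρ P`, `#(C ∖ C*) ≤ t² 2^t (q/D) P` and the crude bound `S_b ≤ W (log M)^t` come
from PIECES 3b/3c. The result (`coset_discrepancy_at`) is the bound
`|Σ_{C*} bandSum (f − g)| ≤ (q/φ(q))^t · P · Bracket` with an explicit `Bracket` that is small once
`W ≍ δ_W N`, `q ≤ N^{θ₁}` (`θ₁ < 1`), `N` is large and `ε₁, …, ε₄` are small — hypothesis (A) of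
`IncidenceRigidity`.
-/

noncomputable section

open scoped BigOperators Classical Topology ArithmeticFunction.vonMangoldt
open Finset Filter MeasureTheory Literature.NumberTheory.Sieve
open Summit.Parity.GeneralizedHardyLittlewood.Cruxes.RelativeDimOne.GallagherBackwards (classPsi)

namespace Summit.Parity.GeneralizedHardyLittlewood.Cruxes.RelativeDimOne.GallagherBackwardsSplit

variable {t : ℕ}

/-! ### Small conversions -/

/-- Band sums are linear: `bandSum (f − g) = bandSum f − bandSum g`. -/
theorem bandSum_sub (Q : ℕ) (f g : ℕ → (Fin t → ℤ) → IncType t → ℝ) (a b : Fin t → ℤ) :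
    bandSum Q (fun q a τ => f q a τ - g q a τ) a b = bandSum Q f a b - bandSum Q g a b := by
  unfold bandSum
  rw [Finset.sum_sub_distrib]

/-- The local type factor is `≥ 0` and `≤ (q/φ(q))^t` (from the local identity, `q ≥ 1`). -/
theorem localTypeFactor_bounds {q : ℕ} (hq : 0 < q) (a c : Fin t → ℤ) :
    0 ≤ localTypeFactor q a c ∧ localTypeFactor q a c ≤ ((q : ℝ) / Nat.totient q) ^ t := by
  have h := card_coprime_classes_eq q a c
  have hq0 : (0 : ℝ) < q := by exact_mod_cast hq
  have hφ : (0 : ℝ) < Nat.totient q := by exact_mod_cast Nat.totient_pos.2 hq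
  have hcnt0 : (0 : ℝ) ≤ ((((Finset.range q).filter
      (fun r : ℕ => ∀ i, Int.gcd (a i * r + c i) q = 1)).card : ℕ) : ℝ) := Nat.cast_nonneg _
  have hcntq : ((((Finset.range q).filter
      (fun r : ℕ => ∀ i, Int.gcd (a i * r + c i) q = 1)).card : ℕ) : ℝ) ≤ q := by
    have : ((Finset.range q).filter (fun r : ℕ => ∀ i, Int.gcd (a i * r + c i) q = 1)).card ≤ q :=
      le_trans (Finset.card_filter_le _ _) (by rw [card_range])
    exact_mod_cast this
  have hpos : 0 < (q : ℝ) * (Nat.totient q : ℝ) ^ t := by positivity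
  constructor
  · have : 0 ≤ (q : ℝ) * (Nat.totient q : ℝ) ^ t * localTypeFactor q a c := by
      rw [← h]; positivity
    nlinarith [this, hpos]
  · rw [div_pow, le_div_iff₀ (pow_pos hφ t)]
    have h1 : (q : ℝ) * (Nat.totient q : ℝ) ^ t * localTypeFactor q a c ≤ q * (q : ℝ) ^ t := by
      rw [← h]
      exact mul_le_mul_of_nonneg_right hcntq (by positivity)
    have h2 : (q : ℝ) * ((Nat.totient q : ℝ) ^ t * localTypeFactor q a c) ≤ q * (q : ℝ) ^ t := by
      rw [← mul_assoc]; exact h1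
    have := le_of_mul_le_mul_left h2 hq0
    linarith

/-- Registered form of the upper bound `localTypeFactor q a c ≤ (q/φ(q))^t` (aux for `stub_inversion`). -/
theorem localTypeFactor_le_pow : ∀ {t : ℕ} (q : ℕ), 0 < q → ∀ (a c : Fin t → ℤ), localTypeFactor q a c ≤ ((q : ℝ) / Nat.totient q) ^ t :=
  fun _ hq a c => (localTypeFactor_bounds hq a c).2

/-- Positivity of a moving window at the two ends of `[0, W)` gives positivity along the real
window `[0, W − 1]` for every shift above the lower corner. -/
theorem window_pos_real {a u b : ℤ} {W : ℕ} (hW : 1 ≤ W) (hpos : ∀ n : ℕ, n < W → 1 ≤ a * n + u)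
    (hb : u ≤ b) {x : ℝ} (hx0 : 0 ≤ x) (hx1 : x ≤ (W : ℝ) - 1) : 0 < (a : ℝ) * x + b := by
  have h0 := hpos 0 (by omega)
  have h1 := hpos (W - 1) (by omega)
  have hu : (1 : ℝ) ≤ u := by
    have : (1 : ℤ) ≤ u := by simpa using h0
    exact_mod_cast this
  have hb' : (u : ℝ) ≤ b := by exact_mod_cast hb
  have hW1 : (((W - 1 : ℕ) : ℤ) : ℝ) = (W : ℝ) - 1 := by
    have : ((W - 1 : ℕ) : ℝ) = (W : ℝ) - 1 := by
      rw [Nat.cast_sub hW, Nat.cast_one]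
    exact_mod_cast this
  have h1' : (1 : ℝ) ≤ a * ((W : ℝ) - 1) + u := by
    have : (1 : ℤ) ≤ a * ((W - 1 : ℕ) : ℤ) + u := h1
    have h := (Int.cast_le (R := ℝ)).2 this
    push_cast at h
    rw [Nat.cast_sub hW, Nat.cast_one] at h
    linarith
  rcases le_or_gt 0 (a : ℝ) with ha | ha
  · nlinarith [mul_nonneg ha hx0]
  · -- `a < 0`: the minimum is at `x = W − 1`
    nlinarith [mul_le_mul_of_nonpos_left hx1 ha.le]

/-- `∏ (X_i+1)/φ(q)^t = (q/φ(q))^t · ∏ (X_i+1)/q^t`. -/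
theorem prod_div_totient_pow {q : ℕ} (hq : 0 < q) (X : Fin t → ℕ) :
    (∏ i, ((X i : ℝ) + 1)) / (Nat.totient q : ℝ) ^ t =
      ((q : ℝ) / Nat.totient q) ^ t * ((∏ i, ((X i : ℝ) + 1)) / (q : ℝ) ^ t) := by
  have hq0 : (0 : ℝ) < q := by exact_mod_cast hq
  have hφ : (0 : ℝ) < Nat.totient q := by exact_mod_cast Nat.totient_pos.2 hq
  rw [div_pow]
  field_simp

/-- Pure bookkeeping: the seven error terms of `coset_discrepancy_abstract`, in the normalisation of
the line, are bounded by `Φ P · Bracket`. -/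
theorem bracket_bound {Φ P LTF β q W ε₁ ε₂ ε₃ ε₄ C₀ N Lg T ρ cC cCs : ℝ}
    (hΦ : 1 ≤ Φ) (hP : 0 ≤ P) (hLTFΦ : LTF ≤ Φ) (hβ : 0 < β) (hρ : 0 ≤ ρ)
    (hε₁ : 0 ≤ ε₁) (hε₂ : 0 ≤ ε₂) (hC₀ : 0 ≤ C₀) (hN : 0 ≤ N) (hLg : 0 ≤ Lg)
    (hT : 0 ≤ T) (hW : 0 ≤ W) (hcC : cC ≤ (1 + ρ) * P) (hcCs : cCs ≤ (1 + ρ) * P) (hcC0 : 0 ≤ cC) :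
    1 / β * LTF * P + (Φ * P * (q + ε₃ * W) + T * P * (W * Lg)) / β
        + ε₁ * (C₀ * (LTF * cC + ε₄ * Φ * P + cCs)) + ε₁ * N * cCs / β + ε₄ * Φ * P + ε₂ * cCs
        + LTF * (ρ * P) ≤
      Φ * P * (1 / β + (q + ε₃ * W) / β + T * (W * Lg) / β + ε₁ * C₀ * (2 * (1 + ρ) + ε₄)
        + ε₁ * N * (1 + ρ) / β + ε₄ + ε₂ * (1 + ρ) + ρ) := by
  have hΦ0 : 0 ≤ Φ := le_trans zero_le_one hΦ
  have hK0 : 0 ≤ (1 + ρ) * P := by positivity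
  have hKΦ : (1 + ρ) * P ≤ Φ * ((1 + ρ) * P) := by nlinarith
  have hPΦ : P ≤ Φ * P := by nlinarith
  have hβ' : 0 ≤ 1 / β := by positivity
  -- T1
  have T1 : 1 / β * LTF * P ≤ Φ * P * (1 / β) := by
    have := mul_le_mul_of_nonneg_right hLTFΦ hP
    calc 1 / β * LTF * P = 1 / β * (LTF * P) := by ring
      _ ≤ 1 / β * (Φ * P) := mul_le_mul_of_nonneg_left this hβ'
      _ = Φ * P * (1 / β) := by ring
  -- T2
  have T2 : (Φ * P * (q + ε₃ * W) + T * P * (W * Lg)) / β ≤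
      Φ * P * ((q + ε₃ * W) / β + T * (W * Lg) / β) := by
    have hx : 0 ≤ T * (W * Lg) := by positivity
    have h1 : T * P * (W * Lg) ≤ T * (Φ * P) * (W * Lg) := by
      have := mul_le_mul_of_nonneg_left hPΦ hT
      calc T * P * (W * Lg) = (T * P) * (W * Lg) := by ring
        _ ≤ (T * (Φ * P)) * (W * Lg) := mul_le_mul_of_nonneg_right this (by positivity)
    have h2 : (Φ * P * (q + ε₃ * W) + T * P * (W * Lg)) / β ≤
        (Φ * P * (q + ε₃ * W) + T * (Φ * P) * (W * Lg)) / β :=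
      div_le_div_of_nonneg_right (by linarith) hβ.le
    calc _ ≤ (Φ * P * (q + ε₃ * W) + T * (Φ * P) * (W * Lg)) / β := h2
      _ = Φ * P * ((q + ε₃ * W) / β + T * (W * Lg) / β) := by
          field_simp
  -- T3
  have T3 : ε₁ * (C₀ * (LTF * cC + ε₄ * Φ * P + cCs)) ≤ Φ * P * (ε₁ * C₀ * (2 * (1 + ρ) + ε₄)) := by
    have h1 : LTF * cC ≤ Φ * ((1 + ρ) * P) := mul_le_mul hLTFΦ hcC hcC0 hΦ0
    have h2 : cCs ≤ Φ * ((1 + ρ) * P) := le_trans hcCs hKΦ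
    have h3 : LTF * cC + ε₄ * Φ * P + cCs ≤ Φ * P * (2 * (1 + ρ) + ε₄) := by nlinarith
    have := mul_le_mul_of_nonneg_left h3 (mul_nonneg hε₁ hC₀)
    calc ε₁ * (C₀ * (LTF * cC + ε₄ * Φ * P + cCs)) = ε₁ * C₀ * (LTF * cC + ε₄ * Φ * P + cCs) := by ring
      _ ≤ ε₁ * C₀ * (Φ * P * (2 * (1 + ρ) + ε₄)) := this
      _ = Φ * P * (ε₁ * C₀ * (2 * (1 + ρ) + ε₄)) := by ring
  -- T4
  have T4 : ε₁ * N * cCs / β ≤ Φ * P * (ε₁ * N * (1 + ρ) / β) := by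
    have h2 : cCs ≤ Φ * ((1 + ρ) * P) := le_trans hcCs hKΦ
    have h3 : ε₁ * N * cCs ≤ ε₁ * N * (Φ * ((1 + ρ) * P)) :=
      mul_le_mul_of_nonneg_left h2 (mul_nonneg hε₁ hN)
    calc ε₁ * N * cCs / β ≤ ε₁ * N * (Φ * ((1 + ρ) * P)) / β := div_le_div_of_nonneg_right h3 hβ.le
      _ = Φ * P * (ε₁ * N * (1 + ρ) / β) := by
          field_simp
  -- T5, T6, T7
  have T5 : ε₄ * Φ * P = Φ * P * ε₄ := by ring
  have T6 : ε₂ * cCs ≤ Φ * P * (ε₂ * (1 + ρ)) := by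
    have h2 : cCs ≤ Φ * ((1 + ρ) * P) := le_trans hcCs hKΦ
    have := mul_le_mul_of_nonneg_left h2 hε₂
    calc ε₂ * cCs ≤ ε₂ * (Φ * ((1 + ρ) * P)) := this
      _ = Φ * P * (ε₂ * (1 + ρ)) := by ring
  have T7 : LTF * (ρ * P) ≤ Φ * P * ρ := by
    have := mul_le_mul_of_nonneg_right hLTFΦ (mul_nonneg hρ hP)
    calc LTF * (ρ * P) ≤ Φ * (ρ * P) := this
      _ = Φ * P * ρ := by ring
  have e : Φ * P * (1 / β + (q + ε₃ * W) / β + T * (W * Lg) / β + ε₁ * C₀ * (2 * (1 + ρ) + ε₄)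
        + ε₁ * N * (1 + ρ) / β + ε₄ + ε₂ * (1 + ρ) + ρ) =
      Φ * P * (1 / β) + Φ * P * ((q + ε₃ * W) / β + T * (W * Lg) / β)
        + Φ * P * (ε₁ * C₀ * (2 * (1 + ρ) + ε₄)) + Φ * P * (ε₁ * N * (1 + ρ) / β) + Φ * P * ε₄
        + Φ * P * (ε₂ * (1 + ρ)) + Φ * P * ρ := by ring
  rw [e]
  linarith [T1, T2, T3, T4, T5.le, T6, T7]

/-! ### The discrepancy at a fixed scale -/

/-- THE COSET DISCREPANCY at scale `N` (see the file header). -/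
theorem coset_discrepancy_at (θ : ℝ) (N : ℕ) (f g : ℕ → (Fin t → ℤ) → IncType t → ℝ) {q : ℕ}
    (hq : 0 < q) (a c u : Fin t → ℤ) (X : Fin t → ℕ) {W : ℕ} (hW2 : 2 ≤ W) (hWN : W ≤ N + 1)
    (ha : ∀ i, a i ≠ 0) {ε₁ ε₂ ε₃ ε₄ C₀ M D : ℝ} (hε₁ : 0 ≤ ε₁) (hε₂ : 0 ≤ ε₂)
    (hC₀ : 0 ≤ C₀) (hM : 1 ≤ M) (hqD : (q : ℝ) ≤ D) (hD : ∀ i, D ≤ (X i : ℝ) + 1)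
    (hpos : ∀ i, ∀ n : ℕ, n < W → 1 ≤ a i * n + u i)
    (hheight : ∀ b ∈ box u X, ∀ i, ∀ n : ℕ, n < W → |((a i * n + b i : ℤ) : ℝ)| ≤ M)
    (hcore : ∀ b ∈ (box u X).filter
        (fun b => (∀ i, Int.ModEq q (b i) (c i)) ∧ IsNondegenerateSystem (sys a b)),
      |vonMangoldtSum (sys a b) (Set.Icc (fun _ => (0 : ℝ)) (fun _ => (W : ℝ) - 1)) N -
          archFactor (sys a b) (Set.Icc (fun _ => (0 : ℝ)) (fun _ => (W : ℝ) - 1)) *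
            bandSum (level θ N) f a b| ≤
        ε₁ * (archFactor (sys a b) (Set.Icc (fun _ => (0 : ℝ)) (fun _ => (W : ℝ) - 1)) *
          |bandSum (level θ N) f a b| + N) ∧
      |bandSum (level θ N) f a b| ≤ C₀ * (singularProduct (sys a b) + 1))
    (hssb : ∀ b ∈ (box u X).filter
        (fun b => (∀ i, Int.ModEq q (b i) (c i)) ∧ IsNondegenerateSystem (sys a b)),
      |singularProduct (sys a b) - bandSum (level θ N) g a b| ≤ ε₂)
    (hmcm : |(∑ n ∈ Finset.range W,
          ∏ i, (classPsi (a i * n + u i + X i).toNat q (resid q (a i * n + c i))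
                - classPsi (a i * n + u i - 1).toNat q (resid q (a i * n + c i))))
        - (∏ i, ((X i : ℝ) + 1)) / (Nat.totient q : ℝ) ^ t *
            (((Finset.range W).filter (fun n : ℕ => ∀ i, Int.gcd (a i * n + c i) q = 1)).card : ℝ)|
        ≤ ε₃ * W * (∏ i, ((X i : ℝ) + 1)) / (Nat.totient q : ℝ) ^ t)
    (hcsm : |(∑ b ∈ (box u X).filter
          (fun b => (∀ i, Int.ModEq q (b i) (c i)) ∧ IsNondegenerateSystem (sys a b)),
        singularProduct (sys a b))
      - localTypeFactor q a c *
          (((box u X).filter (fun b => ∀ i, Int.ModEq q (b i) (c i))).card : ℝ)|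
      ≤ ε₄ * ((q : ℝ) / Nat.totient q) ^ t * (∏ i, ((X i : ℝ) + 1)) / (q : ℝ) ^ t) :
    |∑ b ∈ (box u X).filter
          (fun b => (∀ i, Int.ModEq q (b i) (c i)) ∧ IsNondegenerateSystem (sys a b)),
        bandSum (level θ N) (fun q' a' τ => f q' a' τ - g q' a' τ) a b| ≤
      ((q : ℝ) / Nat.totient q) ^ t * ((∏ i, ((X i : ℝ) + 1)) / (q : ℝ) ^ t) *
        (1 / ((W : ℝ) - 1) + ((q : ℝ) + ε₃ * W) / ((W : ℝ) - 1)
          + t * t * 2 ^ t * ((q : ℝ) / D) * (W * Real.log M ^ t) / ((W : ℝ) - 1)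
          + ε₁ * C₀ * (2 * (1 + t * 2 ^ t * ((q : ℝ) / D)) + ε₄)
          + ε₁ * N * (1 + t * 2 ^ t * ((q : ℝ) / D)) / ((W : ℝ) - 1)
          + ε₄ + ε₂ * (1 + t * 2 ^ t * ((q : ℝ) / D)) + t * 2 ^ t * ((q : ℝ) / D)) := by
  -- Names
  set C : Finset (Fin t → ℤ) := (box u X).filter (fun b => ∀ i, Int.ModEq q (b i) (c i)) with hC
  set Cs : Finset (Fin t → ℤ) := (box u X).filter
    (fun b => (∀ i, Int.ModEq q (b i) (c i)) ∧ IsNondegenerateSystem (sys a b)) with hCs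
  set F : (Fin t → ℤ) → ℝ := fun b => bandSum (level θ N) f a b with hF
  set G : (Fin t → ℤ) → ℝ := fun b => bandSum (level θ N) g a b with hG
  set S : (Fin t → ℤ) → ℝ := fun b => ∑ n ∈ Finset.range W, ∏ i, Λ ((a i * n + b i).toNat) with hS
  set SS : (Fin t → ℤ) → ℝ := fun b => singularProduct (sys a b) with hSS
  set P : ℝ := (∏ i, ((X i : ℝ) + 1)) / (q : ℝ) ^ t with hP
  set Φ : ℝ := ((q : ℝ) / Nat.totient q) ^ t with hΦ
  set LTF : ℝ := localTypeFactor q a c with hLTF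
  set ρ : ℝ := t * 2 ^ t * ((q : ℝ) / D) with hρ
  set β : ℝ := (W : ℝ) - 1 with hβ
  -- basic positivity
  have hq0 : (0 : ℝ) < q := by exact_mod_cast hq
  have hφ0 : (0 : ℝ) < Nat.totient q := by exact_mod_cast Nat.totient_pos.2 hq
  have hD0 : 0 < D := lt_of_lt_of_le hq0 hqD
  have hW1 : 1 ≤ W := by omega
  have hWr : (2 : ℝ) ≤ W := by exact_mod_cast hW2
  have hβ0 : 0 < β := by rw [hβ]; linarith
  have hP0 : 0 < P := by rw [hP]; positivity
  have hΦ1 : 1 ≤ Φ := by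
    rw [hΦ]
    refine one_le_pow₀ ?_
    rw [le_div_iff₀ hφ0, one_mul]
    exact_mod_cast Nat.totient_le q
  have hρ0 : 0 ≤ ρ := by rw [hρ]; positivity
  have hLTFb := localTypeFactor_bounds hq a c
  have hLTF0 : 0 ≤ LTF := hLTFb.1
  have hLTFΦ : LTF ≤ Φ := hLTFb.2
  have hCsC : Cs ⊆ C := by
    intro b hb
    rw [hCs, Finset.mem_filter] at hb
    rw [hC, Finset.mem_filter]
    exact ⟨hb.1, hb.2.1⟩
  -- window identities for shifts of the box
  have hSwin : ∀ b : Fin t → ℤ,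
      vonMangoldtSum (sys a b) (Set.Icc (fun _ => (0 : ℝ)) (fun _ => (W : ℝ) - 1)) N = S b :=
    fun b => vonMangoldtSum_sys_window a b hWN
  have hβwin : ∀ b ∈ box u X,
      archFactor (sys a b) (Set.Icc (fun _ => (0 : ℝ)) (fun _ => (W : ℝ) - 1)) = β := by
    intro b hb
    rw [box, Fintype.mem_piFinset] at hb
    refine archFactor_sys_window a b hW1 fun i x hx0 hx1 => ?_
    exact window_pos_real hW1 (hpos i) (Finset.mem_Icc.1 (hb i)).1 hx0 hx1
  -- h1, h2
  have h1 : ∀ b ∈ Cs, |S b - β * F b| ≤ ε₁ * (β * |F b| + N) := by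
    intro b hb
    have hbB : b ∈ box u X := (Finset.mem_filter.1 hb).1
    have := (hcore b hb).1
    rwa [hSwin b, hβwin b hbB] at this
  have h2 : ∀ b ∈ Cs, |F b| ≤ C₀ * (SS b + 1) := fun b hb => (hcore b hb).2
  have h3 : ∀ b ∈ Cs, |SS b - G b| ≤ ε₂ := fun b hb => hssb b hb
  -- h4 : the evaluated dictionary
  have hdict : ∑ b ∈ C, S b = ∑ n ∈ Finset.range W,
      ∏ i, (classPsi (a i * n + u i + X i).toNat q (resid q (a i * n + c i))
        - classPsi (a i * n + u i - 1).toNat q (resid q (a i * n + c i))) :=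
    dictionary_identity q hq a c u X W hpos
  have hA : (∏ i, ((X i : ℝ) + 1)) / (Nat.totient q : ℝ) ^ t = Φ * P := prod_div_totient_pow hq X
  set cnt : ℕ := ((Finset.range q).filter (fun r : ℕ => ∀ i, Int.gcd (a i * r + c i) q = 1)).card
    with hcnt
  set cntW : ℕ := ((Finset.range W).filter (fun n : ℕ => ∀ i, Int.gcd (a i * n + c i) q = 1)).card
    with hcntW
  have hloc : (cnt : ℝ) * (q : ℝ) ^ t = q * (Nat.totient q : ℝ) ^ t * LTF := card_coprime_classes_eq q a c
  have hwin : |(cntW : ℝ) - (W : ℝ) / q * cnt| ≤ q := abs_card_window_coprime_sub_le hq a c W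
  have hmain : Φ * P * ((W : ℝ) / q * cnt) = W * LTF * P := by
    -- `Φ P (W/q) cnt = (∏(X+1)/φ^t) (W/q) cnt` and `cnt = q φ^t LTF / q^t`
    rw [← hA]
    have hcnt' : (cnt : ℝ) = q * (Nat.totient q : ℝ) ^ t * LTF / (q : ℝ) ^ t := by
      rw [eq_div_iff (pow_ne_zero _ hq0.ne')]; exact hloc
    rw [hcnt', hP]
    field_simp
  have h4 : |∑ b ∈ C, S b - W * LTF * P| ≤ Φ * P * (q + ε₃ * W) := by
    rw [hdict]
    have hm' : |(∑ n ∈ Finset.range W,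
          ∏ i, (classPsi (a i * n + u i + X i).toNat q (resid q (a i * n + c i))
            - classPsi (a i * n + u i - 1).toNat q (resid q (a i * n + c i)))) -
        Φ * P * (cntW : ℝ)| ≤ ε₃ * W * (Φ * P) := by
      have hm := hmcm
      have e : ε₃ * ↑W * (∏ i, ((X i : ℝ) + 1)) / (Nat.totient q : ℝ) ^ t = ε₃ * W * (Φ * P) := by
        rw [mul_div_assoc, hA]
      rw [e, hA] at hm
      exact hm
    have hsecond : |Φ * P * (cntW : ℝ) - W * LTF * P| ≤ Φ * P * q := by
      rw [← hmain, ← mul_sub, abs_mul, abs_of_nonneg (by positivity)]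
      exact mul_le_mul_of_nonneg_left hwin (by positivity)
    calc |(∑ n ∈ Finset.range W,
            ∏ i, (classPsi (a i * n + u i + X i).toNat q (resid q (a i * n + c i))
              - classPsi (a i * n + u i - 1).toNat q (resid q (a i * n + c i)))) - W * LTF * P|
        ≤ |(∑ n ∈ Finset.range W,
            ∏ i, (classPsi (a i * n + u i + X i).toNat q (resid q (a i * n + c i))
              - classPsi (a i * n + u i - 1).toNat q (resid q (a i * n + c i)))) -
            Φ * P * (cntW : ℝ)| + |Φ * P * (cntW : ℝ) - W * LTF * P| := abs_sub_le _ _ _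
      _ ≤ ε₃ * W * (Φ * P) + Φ * P * q := add_le_add hm' hsecond
      _ = Φ * P * (q + ε₃ * W) := by ring
  -- h5
  have h5 : |∑ b ∈ Cs, SS b - LTF * C.card| ≤ ε₄ * Φ * P := by
    have := hcsm
    rw [mul_div_assoc] at this
    exact this
  -- h6, h6', h7, h8
  have h6 : ∀ b ∈ C, 0 ≤ S b := fun b _ => window_sum_nonneg a b W
  have hsdiff : C \ Cs = C.filter (fun b => ¬ IsNondegenerateSystem (sys a b)) := by
    ext b
    simp only [hC, hCs, Finset.mem_sdiff, Finset.mem_filter]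
    tauto
  have h6' : ∀ b ∈ C \ Cs, S b ≤ W * Real.log M ^ t := by
    intro b hb
    have hbB : b ∈ box u X := (Finset.mem_filter.1 (Finset.mem_sdiff.1 hb).1).1
    exact window_sum_le a b W hM (fun i n hn => hheight b hbB i n hn)
  have h7 : (((C \ Cs).card : ℕ) : ℝ) ≤ t * t * 2 ^ t * ((q : ℝ) / D) * P := by
    rw [hsdiff]
    exact card_coset_degenerate_le_real hq u c X a ha hqD hD
  have h8 : |((C.card : ℕ) : ℝ) - P| ≤ ρ * P := abs_card_coset_box_sub_le hq u c X hqD hD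
  -- the abstract inequality
  have hLg0 : 0 ≤ Real.log M ^ t := pow_nonneg (Real.log_nonneg hM) t
  have hSmax0 : 0 ≤ (W : ℝ) * Real.log M ^ t := mul_nonneg (Nat.cast_nonneg W) hLg0
  have habs := coset_discrepancy_abstract C Cs hCsC F G S SS β W N ε₁ ε₂ C₀ LTF P
    (Φ * P * (q + ε₃ * W)) (ε₄ * Φ * P) (W * Real.log M ^ t) (t * t * 2 ^ t * ((q : ℝ) / D) * P) ρ
    hβ0 hε₁ hC₀ hLTF0 hP0.le hSmax0 h1 h2 h3 h4 h5 h6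
    (fun b hb => h6' b (by convert hb using 2; exact congrArg (@Finset.instSDiff _) (Subsingleton.elim _ _)))
    (by convert h7 using 4; exact congrArg (@Finset.instSDiff _) (Subsingleton.elim _ _)) h8
  -- rewrite the goal's sum as `Σ (F − G)`
  have hsum : ∑ b ∈ Cs, bandSum (level θ N) (fun q' a' τ => f q' a' τ - g q' a' τ) a b =
      ∑ b ∈ Cs, (F b - G b) :=
    Finset.sum_congr rfl fun b _ => bandSum_sub _ f g a b
  rw [hsum]
  refine le_trans habs ?_
  -- compare term by term with `Φ P · Bracket`
  have hCard : ((C.card : ℕ) : ℝ) ≤ (1 + ρ) * P := by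
    have := (abs_le.1 h8).2; linarith
  have hCsCard : ((Cs.card : ℕ) : ℝ) ≤ (1 + ρ) * P :=
    le_trans (by exact_mod_cast Finset.card_le_card hCsC) hCard
  have hWβ : |(W : ℝ) / β - 1| = 1 / β := by
    have hne : β ≠ 0 := hβ0.ne'
    have e : (W : ℝ) / β - 1 = 1 / β := by
      rw [hβ] at hne ⊢
      field_simp
      ring
    rw [e, abs_of_pos (one_div_pos.2 hβ0)]
  rw [hWβ]
  exact bracket_bound hΦ1 hP0.le hLTFΦ hβ0 hρ0 hε₁ hε₂ hC₀ (Nat.cast_nonneg N) hLg0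
    (by positivity) (Nat.cast_nonneg W) hCard hCsCard (Nat.cast_nonneg _)

end Summit.Parity.GeneralizedHardyLittlewood.Cruxes.RelativeDimOne.GallagherBackwardsSplit
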